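import Summits.BirchSwinnertonDyer.Rank1Residual.GaloisImage.SelmerPairCounting
import Literature.NumberTheory.GaloisCohomology.KolyvaginSystems
import HarnessLib

/-!
# The Selmer structures `𝓕(d)`, `𝓕(d𝔮)`, `𝓕_𝔮(d)`, `𝓕^𝔮(d)` at Kolyvagin levels: unfolding,
# finiteness, and pair counting at one place (Rubin, PCMI Lecture 2, Def. 2.1.1 / Prop. 2.6.1 (3))
# (cell `b2b-bsdres`, team n1011, ROUTE-1 item R1-16, file 1 of 3 — lead ruling PLAN.md R5-29 (q);
# seat p11; skeleton `cells/n1011/skel/T-R1-16.md`)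

HONEST FRAMING (verbatim for the cell): research route; prove what is provable now; shrink each hard
class to its core with data; no claim beyond stated classes; nothing booked; no mark / label moved.
TOOL lemmas about Selmer structures of a finite Galois module; theorems only — no definition, no
named fact, no conjecture node.

For a Selmer structure `𝓕` on a finite discrete `Γ_K`-module `M` and a Kolyvagin datum `D`
(`Literature/…/GaloisCohomology/KolyvaginSystems.lean`: primes `𝒫`, transverse conditions, comparison
maps), the structures of Rubin's Def. 2.1.1 are the tree's `D.atLevel 𝓕 d = 𝓕(d)`,
`(D.atLevel 𝓕 d).strictAt {𝔮} = 𝓕_𝔮(d)`, `(D.atLevel 𝓕 d).relaxedAt {𝔮} = 𝓕^𝔮(d)`.  This file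
supplies what the vanishing theorem `χ(𝓕) = 0 ⟹ KS₁ = 0` (file 3, `KolyvaginSystemsCoreRankZero`)
needs about them:

* §1 dual local conditions of a join and of everything (`dualLocalCondition_sup`,
  `dualLocalCondition_top_of_isPerfect`);
* §2 Selmer groups of structures agreeing off one place (`mem_selmerGroup_of_forall_ne`) and the
  FINITENESS TRANSFER `finite_selmerGroup_of_le_off` (the kernel of `loc_T` on `H¹_{𝓛'}` lies in a
  finite `H¹_𝓛`, and `⊕_{v∈T} H¹(K_v, M)` is finite);
* §3 the four structures unfolded place by place, and their `IsUnramifiedOutside` (namespace `Level`);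
* §4 `card_selmerGroup_pair_one_place`: the pair-counting form of Poitou–Tate duality
  (`card_selmerGroup_pair`, `SelmerPairCounting.lean`, T-a3-F1 CR1) for two structures that differ at
  ONE finite place `𝔮`: `#H¹_𝓑 · #H¹_{𝓐^*} · #𝓐_𝔮 = #H¹_𝓐 · #H¹_{𝓑^*} · #𝓑_𝔮` — the counting behind
  Rubin's Prop. 2.6.1 (3) `a + a^* = c + c^* = m`;
* §5 finiteness of the Selmer groups of all these structures from that of `H¹_𝓕` and `H¹_{𝓕^*}`.

References: [Rubin2011] K. Rubin, *Euler systems and Kolyvagin systems*, PCMI 18 (2011), Def. 2.1.1,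
Thm. 1.10.2, Prop. 2.6.1 (pp. 15–22) — read (held); [Sakamoto2024] §3 Def. 3.3 (the notation
`𝓕^a_b(c)` of the tree's `SelmerStructure.modify`).
-/

noncomputable section

open scoped Classical NumberField ContRepresentation
open Function NumberField IsDedekindDomain
open Literature.NumberTheory.GaloisRepresentations Literature.NumberTheory.GaloisRepresentations.DiscreteGaloisModule
  Literature.NumberTheory.GaloisCohomology

universe u

namespace Summit.BirchSwinnertonDyer.Rank1Residual.GaloisImage.CoreRankZero

variable {K : Type u} [Field K] [NumberField K] {n : ℕ}
variable {M : Type u} [AddCommGroup M] [TopologicalSpace M] [DiscreteTopology M]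
variable {ρ : DiscreteGaloisModule K M}

/-! ## §1. Dual local conditions: lattice bookkeeping -/

section Finite

variable [Finite M]

/-- The dual local condition of a join is the meet of the dual local conditions. [folklore] -/
theorem dualLocalCondition_sup (inv : LocalInvariants K n) (ρ : DiscreteGaloisModule K M)
    (v : Place K) (L L' : AddSubgroup (galoisCohomology (ρ.toLocal v) 1)) :
    inv.dualLocalCondition ρ v (L ⊔ L') =
      inv.dualLocalCondition ρ v L ⊓ inv.dualLocalCondition ρ v L' := by
  refine le_antisymm (le_inf (inv.dualLocalCondition_anti ρ v le_sup_left)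
    (inv.dualLocalCondition_anti ρ v le_sup_right)) ?_
  rintro b ⟨h, h'⟩ a ha
  obtain ⟨a₁, ha₁, a₂, ha₂, rfl⟩ := AddSubgroup.mem_sup.mp ha
  rw [map_add, AddMonoidHom.add_apply, h a₁ ha₁, h' a₂ ha₂, add_zero]

/-- For a family with perfect local pairings at the finite places (`IsPerfect`), the dual local
condition of the relaxed condition is the strict one: `(H¹(K_v, M))^* = 0`. [folklore] -/
theorem dualLocalCondition_top_of_isPerfect {inv : LocalInvariants K n} (hperf : inv.IsPerfect)
    (ρ : DiscreteGaloisModule K M) (hM : ∀ m : M, n • m = 0) (v : HeightOneSpectrum (𝓞 K)) :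
    inv.dualLocalCondition ρ (Sum.inr v) ⊤ = ⊥ := by
  rw [eq_bot_iff]
  intro b hb
  rw [AddSubgroup.mem_bot]
  have hinj := ((hperf v).2 ρ hM).2.1
  have h0 : (localTatePairingZMod ρ n (Sum.inr v) (inv (Sum.inr v))).flip b = 0 := by
    ext a
    simp only [AddMonoidHom.flip_apply, AddMonoidHom.zero_apply]
    exact hb a (AddSubgroup.mem_top a)
  exact (injective_iff_map_eq_zero _).mp hinj b h0

/-! ## §2. Selmer groups of structures that agree off one finite place -/

omit [Finite M] in
/-- If `𝓛' ≤ 𝓛` at every place other than the finite place `q`, a class of `H¹_{𝓛'}(K, M)` whose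
localisation at `q` lies in `𝓛_q` lies in `H¹_𝓛(K, M)`. [folklore] -/
theorem mem_selmerGroup_of_forall_ne {𝓛 𝓛' : SelmerStructure ρ} (q : HeightOneSpectrum (𝓞 K))
    (h : ∀ v : Place K, v ≠ Sum.inr q → 𝓛' v ≤ 𝓛 v) {x : galoisCohomology ρ 1}
    (hx : x ∈ 𝓛'.selmerGroup) (hq : galoisCohomology.localization ρ (Sum.inr q) 1 x ∈ 𝓛 (Sum.inr q)) :
    x ∈ 𝓛.selmerGroup := by
  rw [SelmerStructure.mem_selmerGroup_iff] at hx ⊢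
  intro v
  by_cases hv : v = Sum.inr q
  · subst hv; exact hq
  · exact h v hv (hx v)

/-- **Finiteness transfer.** If `𝓛'_v ≤ 𝓛_v` at every place outside a finite set `T` of finite
places and `H¹_𝓛(K, M)` is finite, then `H¹_{𝓛'}(K, M)` is finite: the kernel of
`H¹_{𝓛'}(K, M) → ⊕_{v ∈ T} H¹(K_v, M)` lies in `H¹_𝓛(K, M)` and the target is finite. [folklore] -/
theorem finite_selmerGroup_of_le_off (T : Finset (HeightOneSpectrum (𝓞 K)))
    {𝓛 𝓛' : SelmerStructure ρ} (h : ∀ v : Place K, (∀ q ∈ T, v ≠ Sum.inr q) → 𝓛' v ≤ 𝓛 v)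
    (hfin : Finite 𝓛.selmerGroup) : Finite 𝓛'.selmerGroup := by
  classical
  let φ : 𝓛'.selmerGroup →+ (Π v : T, galoisCohomology (ρ.toLocal (Sum.inr v.1)) 1) :=
    (locPi ρ T).comp 𝓛'.selmerGroup.subtype
  -- the kernel of `loc_T` on `H¹_{𝓛'}` injects into `H¹_𝓛`
  have hker : ∀ x : 𝓛'.selmerGroup, φ x = 0 → (x : galoisCohomology ρ 1) ∈ 𝓛.selmerGroup := by
    intro x hx
    have hx' := x.2
    rw [SelmerStructure.mem_selmerGroup_iff] at hx' ⊢
    intro v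
    by_cases hv : ∀ q ∈ T, v ≠ Sum.inr q
    · exact h v hv (hx' v)
    · push Not at hv
      obtain ⟨q, hq, rfl⟩ := hv
      have := congrFun hx ⟨q, hq⟩
      simp only [φ, AddMonoidHom.coe_comp, comp_apply, AddSubgroup.coe_subtype, locPi_apply,
        Pi.zero_apply] at this
      rw [this]
      exact zero_mem _
  haveI : Finite φ.ker := by
    refine Finite.of_injective (fun x : φ.ker => (⟨(x.1 : galoisCohomology ρ 1), hker x.1 x.2⟩ :
      𝓛.selmerGroup)) ?_
    intro x y hxy
    have := congrArg Subtype.val hxy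
    exact Subtype.ext (Subtype.ext this)
  haveI : Finite (𝓛'.selmerGroup ⧸ φ.ker) :=
    Finite.of_equiv _ (QuotientAddGroup.quotientKerEquivRange φ).symm.toEquiv
  exact Finite.of_addSubgroup_quotient φ.ker

end Finite

/-! ## §3. The structures `𝓕(d)`, `𝓕(d𝔮)`, `𝓕_𝔮(d)`, `𝓕^𝔮(d)` of Rubin's Prop. 2.6.1, unfolded -/

namespace Level

variable (D : KolyvaginDatum ρ) (𝓕 : SelmerStructure ρ)

/-- `𝓕(d)_v = 𝓕_v` at a finite place `v ∉ d`. [cite: Rubin2011, Def. 2.1.1 (p. 17)] -/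
theorem atLevel_inr_of_not_mem {d : Finset (HeightOneSpectrum (𝓞 K))} {v : HeightOneSpectrum (𝓞 K)}
    (hv : v ∉ d) : D.atLevel 𝓕 d (Sum.inr v) = 𝓕 (Sum.inr v) :=
  SelmerStructure.modify_inr_of_not_mem 𝓕 D.transverse (Finset.notMem_empty v)
    (Finset.notMem_empty v) hv

/-- `𝓕(d)_v = H¹_tr(K_v, M)` at `v ∈ d`. [cite: Rubin2011, Def. 2.1.1 (p. 17)] -/
theorem atLevel_inr_of_mem {d : Finset (HeightOneSpectrum (𝓞 K))} {v : HeightOneSpectrum (𝓞 K)}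
    (hv : v ∈ d) : D.atLevel 𝓕 d (Sum.inr v) = D.transverse (Sum.inr v) :=
  SelmerStructure.modify_inr_of_mem_transverse 𝓕 D.transverse (Finset.notMem_empty v)
    (Finset.notMem_empty v) hv

/-- `𝓕(d)_w = 𝓕_w` at an infinite place. [cite: Rubin2011, Def. 2.1.1 (p. 17)] -/
theorem atLevel_inl (d : Finset (HeightOneSpectrum (𝓞 K))) (w : InfinitePlace K) :
    D.atLevel 𝓕 d (Sum.inl w) = 𝓕 (Sum.inl w) := rfl

/-- `𝓕(d𝔮)` and `𝓕(d)` agree at every place other than `𝔮`. [cite: Rubin2011, Def. 2.1.1 (p. 17)] -/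
theorem atLevel_insert_apply_of_ne {d : Finset (HeightOneSpectrum (𝓞 K))} (q : HeightOneSpectrum (𝓞 K))
    {v : Place K} (hv : v ≠ Sum.inr q) : D.atLevel 𝓕 (insert q d) v = D.atLevel 𝓕 d v := by
  cases v with
  | inl w => rfl
  | inr v =>
    have hvq : v ≠ q := fun h => hv (by rw [h])
    by_cases hvd : v ∈ d
    · rw [atLevel_inr_of_mem D 𝓕 hvd, atLevel_inr_of_mem D 𝓕 (Finset.mem_insert_of_mem hvd)]
    · rw [atLevel_inr_of_not_mem D 𝓕 hvd, atLevel_inr_of_not_mem D 𝓕]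
      simp [hvq, hvd]

/-- `𝓕(d𝔮)_𝔮 = H¹_tr(K_𝔮, M)`. [cite: Rubin2011, Def. 2.1.1 (p. 17)] -/
theorem atLevel_insert_inr_self (d : Finset (HeightOneSpectrum (𝓞 K))) (q : HeightOneSpectrum (𝓞 K)) :
    D.atLevel 𝓕 (insert q d) (Sum.inr q) = D.transverse (Sum.inr q) :=
  atLevel_inr_of_mem D 𝓕 (Finset.mem_insert_self q d)

/-- `𝓕_𝔮(d)` (strict at `𝔮`) and `𝓕(d)` agree off `𝔮`. [cite: Rubin2011, Def. 2.1.1 (p. 17)] -/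
theorem strictAt_apply_of_ne (𝓖 : SelmerStructure ρ) (q : HeightOneSpectrum (𝓞 K)) {v : Place K}
    (hv : v ≠ Sum.inr q) : 𝓖.strictAt {q} v = 𝓖 v := by
  cases v with
  | inl w => rfl
  | inr v =>
    have hvq : v ∉ ({q} : Finset _) := fun h => hv (by rw [Finset.mem_singleton.mp h])
    exact SelmerStructure.modify_inr_of_not_mem 𝓖 𝓖 (Finset.notMem_empty v) hvq
      (Finset.notMem_empty v)

/-- `𝓕_𝔮(d)_𝔮 = 0`. [cite: Rubin2011, Def. 2.1.1 (p. 17)] -/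
theorem strictAt_inr_self (𝓖 : SelmerStructure ρ) (q : HeightOneSpectrum (𝓞 K)) :
    𝓖.strictAt {q} (Sum.inr q) = ⊥ :=
  SelmerStructure.modify_inr_of_mem_strict 𝓖 𝓖 (Finset.notMem_empty q) (Finset.mem_singleton_self q)

/-- `𝓕^𝔮(d)` (relaxed at `𝔮`) and `𝓕(d)` agree off `𝔮`. [cite: Rubin2011, Def. 2.1.1 (p. 17)] -/
theorem relaxedAt_apply_of_ne (𝓖 : SelmerStructure ρ) (q : HeightOneSpectrum (𝓞 K)) {v : Place K}
    (hv : v ≠ Sum.inr q) : 𝓖.relaxedAt {q} v = 𝓖 v := by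
  cases v with
  | inl w => rfl
  | inr v =>
    have hvq : v ∉ ({q} : Finset _) := fun h => hv (by rw [Finset.mem_singleton.mp h])
    exact SelmerStructure.modify_inr_of_not_mem 𝓖 𝓖 hvq (Finset.notMem_empty v)
      (Finset.notMem_empty v)

/-- `𝓕^𝔮(d)_𝔮 = H¹(K_𝔮, M)`. [cite: Rubin2011, Def. 2.1.1 (p. 17)] -/
theorem relaxedAt_inr_self (𝓖 : SelmerStructure ρ) (q : HeightOneSpectrum (𝓞 K)) :
    𝓖.relaxedAt {q} (Sum.inr q) = ⊤ :=
  SelmerStructure.modify_inr_of_mem_relaxed 𝓖 𝓖 (Finset.mem_singleton_self q)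

/-- `𝓕(d)` is unramified outside `S ∪ d` if `𝓕` is unramified outside `S`.
[cite: Rubin2011, Def. 2.1.1 (p. 17)] -/
theorem isUnramifiedOutside_atLevel {S : Finset (Place K)} (h𝓕 : 𝓕.IsUnramifiedOutside S)
    (d : Finset (HeightOneSpectrum (𝓞 K))) {S' : Finset (Place K)} (hSS' : S ⊆ S')
    (hd : ∀ q ∈ d, (Sum.inr q : Place K) ∈ S') : (D.atLevel 𝓕 d).IsUnramifiedOutside S' := by
  refine ⟨fun w => hSS' (h𝓕.1 w), fun v hv => ?_⟩
  have hvd : v ∉ d := fun h => hv (hd v h)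
  rw [atLevel_inr_of_not_mem D 𝓕 hvd]
  exact h𝓕.2 v fun h => hv (hSS' h)

/-- A structure modified at one finite place `𝔮 ∈ S'` of a structure unramified outside `S'` is
unramified outside `S'`. [folklore] -/
theorem isUnramifiedOutside_of_apply_eq_of_ne {𝓖 𝓖' : SelmerStructure ρ} {S' : Finset (Place K)}
    (h𝓖 : 𝓖.IsUnramifiedOutside S') (q : HeightOneSpectrum (𝓞 K)) (hq : (Sum.inr q : Place K) ∈ S')
    (h : ∀ v : Place K, v ≠ Sum.inr q → 𝓖' v = 𝓖 v) : 𝓖'.IsUnramifiedOutside S' := by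
  refine ⟨h𝓖.1, fun v hv => ?_⟩
  have hvq : (Sum.inr v : Place K) ≠ Sum.inr q := fun h' => hv (h' ▸ hq)
  rw [h _ hvq]
  exact h𝓖.2 v hv

end Level

variable [Finite M]

/-! ## §4. Pair counting at one place (the relative Poitou–Tate formula, p13's CR1, specialised) -/

/-- **Pair counting for two Selmer structures that differ at one finite place** — the relative
Greenberg–Wiles / Poitou–Tate counting formula `card_selmerGroup_pair` of
`SelmerPairCounting.lean` (T-a3-F1 CR1), specialised: for `𝓐 ≤ 𝓑` unramified outside a finite
set of places `S'` (`S'` containing the infinite places, the places above `n` and the ramified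
places), equal at every place other than the finite place `𝔮 ∈ S'`,
`#H¹_𝓑 · #H¹_{𝓐^*} · #𝓐_𝔮 = #H¹_𝓐 · #H¹_{𝓑^*} · #𝓑_𝔮` (the common local factors at the other
places of `S'` cancel).  This is the counting behind Rubin's `a + a^* = c + c^* = m`
(Prop. 2.6.1 (3)). [cite: Rubin2011, Thm. 1.10.2 (p. 15) and Prop. 2.6.1 (3) (p. 22)] -/
theorem card_selmerGroup_pair_one_place [NeZero n] {inv : LocalInvariants K n}
    (hperf : inv.IsPerfect) (hsum : inv.SumLocalTermEqZero) (hcompl : inv.SelmerComplement)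
    (hM : ∀ m : M, n • m = 0) {S' : Finset (Place K)}
    (hS' : ∀ v : HeightOneSpectrum (𝓞 K), (Sum.inr v : Place K) ∉ S' →
      ((n : ℕ) : 𝓞 K) ∉ v.asIdeal ∧ GaloisRep.IsUnramifiedAt v ρ)
    {𝓐 𝓑 : SelmerStructure ρ} (hle : 𝓐 ≤ 𝓑) (h𝓐 : 𝓐.IsUnramifiedOutside S')
    (h𝓑 : 𝓑.IsUnramifiedOutside S') (q : HeightOneSpectrum (𝓞 K)) (hq : (Sum.inr q : Place K) ∈ S')
    (heq : ∀ v : Place K, v ≠ Sum.inr q → 𝓐 v = 𝓑 v) :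
    Nat.card 𝓑.selmerGroup * Nat.card (inv.dualSelmerStructure ρ 𝓐).selmerGroup *
        Nat.card (𝓐 (Sum.inr q)) =
      Nat.card 𝓐.selmerGroup * Nat.card (inv.dualSelmerStructure ρ 𝓑).selmerGroup *
        Nat.card (𝓑 (Sum.inr q)) := by
  classical
  -- the finite places of `S'`, so that `S' ⊆ S(T) = ∞ ∪ T`
  let T : Finset (HeightOneSpectrum (𝓞 K)) := S'.preimage Sum.inr Sum.inr_injective.injOn
  have hT : ∀ v : HeightOneSpectrum (𝓞 K), v ∈ T ↔ (Sum.inr v : Place K) ∈ S' := fun v =>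
    Finset.mem_preimage
  have hSub : S' ⊆ finSupport T := by
    intro v hv
    rcases v with w | v
    · exact inl_mem_finSupport T w
    · exact (inr_mem_finSupport_iff T v).2 ((hT v).2 hv)
  have h𝓐' : 𝓐.IsUnramifiedOutside (finSupport T) :=
    ⟨fun w => inl_mem_finSupport T w, fun v hv => h𝓐.2 v fun h => hv (hSub h)⟩
  have h𝓑' : 𝓑.IsUnramifiedOutside (finSupport T) :=
    ⟨fun w => inl_mem_finSupport T w, fun v hv => h𝓑.2 v fun h => hv (hSub h)⟩
  have hS'' : ∀ v : HeightOneSpectrum (𝓞 K), v ∉ T →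
      ((n : ℕ) : 𝓞 K) ∉ v.asIdeal ∧ GaloisRep.IsUnramifiedAt v ρ :=
    fun v hv => hS' v fun h => hv ((hT v).2 h)
  have hinf : ∀ w : InfinitePlace K, 𝓐 (Sum.inl w) = 𝓑 (Sum.inl w) :=
    fun w => heq _ Sum.inl_ne_inr
  have P := card_selmerGroup_pair ρ T inv hperf hsum hcompl hM hS'' hle h𝓐' h𝓑' hinf
  -- split off the factor at `𝔮`; the remaining local factors agree and are positive
  have hqT : q ∈ T := (hT q).2 hq
  rw [← Finset.prod_erase_mul T _ hqT, ← Finset.prod_erase_mul T _ hqT] at P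
  have hprod : ∏ v ∈ T.erase q, Nat.card (𝓐 (Sum.inr v)) =
      ∏ v ∈ T.erase q, Nat.card (𝓑 (Sum.inr v)) :=
    Finset.prod_congr rfl fun v hv => by
      rw [heq _ fun h => Finset.ne_of_mem_erase hv (Sum.inr_injective h)]
  rw [hprod] at P
  have hpos : ∏ v ∈ T.erase q, Nat.card (𝓑 (Sum.inr v)) ≠ 0 :=
    Finset.prod_ne_zero_iff.2 fun v _ => by
      haveI := finite_galoisCohomology_one_toLocal ρ v
      exact Nat.card_pos.ne'
  refine mul_left_cancel₀ hpos ?_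
  calc (∏ v ∈ T.erase q, Nat.card (𝓑 (Sum.inr v))) *
        (Nat.card 𝓑.selmerGroup * Nat.card (inv.dualSelmerStructure ρ 𝓐).selmerGroup *
          Nat.card (𝓐 (Sum.inr q)))
      = Nat.card 𝓑.selmerGroup * Nat.card (inv.dualSelmerStructure ρ 𝓐).selmerGroup *
          ((∏ v ∈ T.erase q, Nat.card (𝓑 (Sum.inr v))) * Nat.card (𝓐 (Sum.inr q))) := by ring
    _ = Nat.card 𝓐.selmerGroup * Nat.card (inv.dualSelmerStructure ρ 𝓑).selmerGroup *
          ((∏ v ∈ T.erase q, Nat.card (𝓑 (Sum.inr v))) * Nat.card (𝓑 (Sum.inr q))) := P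
    _ = _ := by ring

/-! ## §5. The setting of Rubin's Lecture 2 at `m = 1`, as hypotheses on `(𝓕, S, D)` -/

/-- The running hypotheses on the Selmer structure and the Kolyvagin datum, bundled as a
structure-free predicate would be a definition; instead each theorem below carries the binders it
uses.  This lemma records the finiteness of all the Selmer groups met along the way: for every
level `d` and `𝔮`, the Selmer groups of `𝓕(d)`, `𝓕_𝔮(d)`, `𝓕^𝔮(d)` and of their duals are finite
once `H¹_𝓕(K, M)` and `H¹_{𝓕^*}(K, M^D)` are. [folklore] -/
theorem finite_selmerGroup_atLevel (D : KolyvaginDatum ρ) (𝓕 : SelmerStructure ρ)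
    (hfin : Finite 𝓕.selmerGroup) (d : Finset (HeightOneSpectrum (𝓞 K))) :
    Finite (D.atLevel 𝓕 d).selmerGroup := by
  refine finite_selmerGroup_of_le_off d (fun v hv => le_of_eq ?_) hfin
  cases v with
  | inl w => rfl
  | inr v => exact Level.atLevel_inr_of_not_mem D 𝓕 fun h => hv v h rfl

/-- Finiteness of the Selmer group of any structure agreeing with `𝓕(d)` off one more finite place
`𝔮` (used for `𝓕_𝔮(d)` and `𝓕^𝔮(d)`). [folklore] -/
theorem finite_selmerGroup_of_eq_atLevel_off (D : KolyvaginDatum ρ) (𝓕 : SelmerStructure ρ)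
    (hfin : Finite 𝓕.selmerGroup) (d : Finset (HeightOneSpectrum (𝓞 K)))
    (q : HeightOneSpectrum (𝓞 K)) {𝓛 : SelmerStructure ρ}
    (h : ∀ v : Place K, v ≠ Sum.inr q → 𝓛 v = D.atLevel 𝓕 d v) : Finite 𝓛.selmerGroup := by
  refine finite_selmerGroup_of_le_off (insert q d) (fun v hv => le_of_eq ?_) hfin
  rw [h v (hv q (Finset.mem_insert_self q d))]
  cases v with
  | inl w => rfl
  | inr v => exact Level.atLevel_inr_of_not_mem D 𝓕 fun h' => hv v (Finset.mem_insert_of_mem h') rfl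

/-- Finiteness of the dual Selmer groups `H¹_{𝓕(d)^*}(K, M^D)` from that of `H¹_{𝓕^*}(K, M^D)`.
[folklore] -/
theorem finite_dualSelmerGroup_atLevel [NeZero n] (inv : LocalInvariants K n) (D : KolyvaginDatum ρ)
    (𝓕 : SelmerStructure ρ) (hfin : Finite (inv.dualSelmerStructure ρ 𝓕).selmerGroup)
    (d : Finset (HeightOneSpectrum (𝓞 K))) :
    Finite (inv.dualSelmerStructure ρ (D.atLevel 𝓕 d)).selmerGroup := by
  haveI := DiscreteGaloisModule.TateDual.finite K M n
  refine finite_selmerGroup_of_le_off d (fun v hv => le_of_eq ?_) hfin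
  rw [LocalInvariants.dualSelmerStructure_apply, LocalInvariants.dualSelmerStructure_apply]
  cases v with
  | inl w => rfl
  | inr v => rw [Level.atLevel_inr_of_not_mem D 𝓕 fun h => hv v h rfl]

/-- Finiteness of the dual Selmer group of any structure agreeing with `𝓕(d)` off one more finite
place `𝔮`. [folklore] -/
theorem finite_dualSelmerGroup_of_eq_atLevel_off [NeZero n] (inv : LocalInvariants K n)
    (D : KolyvaginDatum ρ) (𝓕 : SelmerStructure ρ)
    (hfin : Finite (inv.dualSelmerStructure ρ 𝓕).selmerGroup) (d : Finset (HeightOneSpectrum (𝓞 K)))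
    (q : HeightOneSpectrum (𝓞 K)) {𝓛 : SelmerStructure ρ}
    (h : ∀ v : Place K, v ≠ Sum.inr q → 𝓛 v = D.atLevel 𝓕 d v) :
    Finite (inv.dualSelmerStructure ρ 𝓛).selmerGroup := by
  haveI := DiscreteGaloisModule.TateDual.finite K M n
  refine finite_selmerGroup_of_le_off (insert q d) (fun v hv => le_of_eq ?_) hfin
  rw [LocalInvariants.dualSelmerStructure_apply, LocalInvariants.dualSelmerStructure_apply,
    h v (hv q (Finset.mem_insert_self q d))]
  cases v with
  | inl w => rfl
  | inr v => rw [Level.atLevel_inr_of_not_mem D 𝓕 fun h' => hv v (Finset.mem_insert_of_mem h') rfl]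

end Summit.BirchSwinnertonDyer.Rank1Residual.GaloisImage.CoreRankZero

end
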